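import Literature.NumberTheory.LFunctions.Zhang2022.RepairGapLemma58Premise
import Literature.NumberTheory.LFunctions.Zhang2022.Section12U030ResidueTwo
import HarnessLib

/-!
# Zhang (2022), rescue GAP/BED (D-0124 (3)(4)(5)): §12 p. 70 — the exceptional-zero residue of the `Ξ₁₂` contour evaluation
# against its model under `‖L(1,χ)‖ ≤ 𝓛⁻¹⁵`, SHARP FORM (the product `L′(1,χ)·(1 − ρ̃)` carried through Lemma 5.8)

Topic `Literature/NumberTheory/LFunctions/Zhang2022` (Landau–Siegel audit tree; verdict-neutral).
Y. Zhang, *Discrete mean estimates and the Landau–Siegel zero*, arXiv:2211.02515v1 (2022)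
[Zhang2022LandauSiegel] — **an unrefereed manuscript under adjudication; nothing in this file asserts or
denies its Theorems 1–2, and nothing here is a claim about Landau–Siegel zeros. The programme SEARCHES and
TYPES; no claim about Landau–Siegel zeros, Theorems 1–2 of arXiv:2211.02515 or a repaired Margin232 until a
kernel theorem says so.**

OPTIMALITY AUDIT (rescue (5)) of the §12 step u030. The tree's second-residue core `Lemma84.norm_resTwo_sub_model_le`
(twin at `𝓛⁻¹⁵`: `norm_resTwo_sub_model_le_pow15`, p590627) bounds three error pieces by `ℓ₁·(1 − ρ̃)` with
`ℓ₁ = 2e^{9/2}(1+𝓛)𝓛 ≥ |L′(1,χ)|`, and the bookkeeping `Lemma84.resTwo_le` then needs `1 − ρ̃ ≤ K_ρ𝓛⁻¹⁷` to reach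
`𝓛⁻¹⁵Π̂²` (`RepairGapSection12U030Doors17`: the step is kernel at exponent 17, p611075). But in the coefficient algebra
(`Lemma84.norm_coeff_sub_model_le`) and in the kernel-difference piece those three terms are EXACTLY `|L′(1,χ)|·(1 − ρ̃)`, and
**`|L′(1,χ)|·(1 − ρ̃) = |L(ρ̃,χ) − L′(1,χ)(ρ̃ − 1)| ≤ E := C₅𝓛⁻¹⁵`** is Lemma 5.8 at the exceptional zero itself
(`L(ρ̃,χ) = 0`, `1 − ρ̃ ≤ α/4`; door `Repair.Gap.lemma58_of_norm_le_pow15`, i.e. exponent 15). This file proves the core with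
that product carried through:

* `norm_resTwo_sub_model_le_pow15_sharp` — hypotheses of `norm_resTwo_sub_model_le_pow15` plus `L(ρ̃,χ) = 0`; in the bound,
  `4Π̂²ℓ₁Kα(1−ρ̃)` becomes `4Π̂²KαE` and the kernel-difference piece `Π̂²ℓ₁K²α²·e^π((2e(1−ρ̃)log Y + 1/(2Λ))(4/α) + (1−ρ̃)·8/α²)`
  becomes `Π̂²K²α²·e^π((2e·E·log Y + ℓ₁/(2Λ))(4/α) + E·8/α²)` — no bare `1 − ρ̃` left except inside `E′` (which carries `α²`).

With the matching bookkeeping (`RepairGapSection12U030Bookkeeping15`) the u030 step closes at exponent 15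
(`RepairGapSection12U030Premise15`). Proof = the tree core verbatim up to the two final estimates. Theorems only; no
definition, no named fact; nothing about (A) itself.

## References

* Y. Zhang, arXiv:2211.02515v1 (2022), §12 p. 70 (proof of Lemma 12.3); §8 Lemma 8.4 (proof); §5 Lemma 5.8.
  [cite: Zhang2022LandauSiegel, §12 p.70] [cite: MontgomeryVaughan2007, §6.2]
-/

noncomputable section

open Complex Real

namespace Literature.NumberTheory.LFunctions.Zhang2022.Lemma84

open Literature.NumberTheory.LFunctions.Zhang2022.Skeleton
open Literature.NumberTheory.LFunctions.Zhang2022.GaussWeight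

variable {D : ℕ} [NeZero D] (χ : DirichletCharacter ℂ D) (c' : ℝ)

set_option maxHeartbeats 1000000 in
/-- **The exceptional-zero residue against the model under `‖L(1,χ)‖ ≤ 𝓛⁻¹⁵`, sharp form** (variant of
`Lemma84.norm_resTwo_sub_model_le_pow15` with the extra hypothesis `L(ρ̃,χ) = 0` and the product `|L′(1,χ)|(1 − ρ̃)` bounded
by the Lemma 5.8 error `E = (1 + 16e^{9/2}π²K²)𝓛⁻¹⁵` instead of by `ℓ₁(1 − ρ̃)`): for `|w| = α`, `s = w − β₆`, `τ = (ρ̃−1) − s`,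
`‖r·K(τ) − L′(1,χ)Π(d,r)β_aβ_b·Y^{−s}/(−s)‖ ≤ (8e^π/α)(8E_Uℓ₁K²α² + 6Π̂²KαE + 2Π̂²K²α²E′ + 4Π̂²KαE)
+ Π̂²K²α²·e^π((2e·E·log Y + ℓ₁/(2Λ))(4/α) + E·8/α²)`. [cite: Zhang2022LandauSiegel, §12 p. 70 (proof of Lemma 12.3); §8 Lemma 8.4 (proof); §5 Lemma 5.8] -/
theorem norm_resTwo_sub_model_le_pow15_sharp (hprim : χ.IsPrimitive) (h𝓛 : 3 ≤ Real.log D)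
    (h15 : ‖χ.LFunction 1‖ ≤ 1 / Real.log D ^ 15) (j : ℕ) {d r : ℕ} (hd : d ≠ 0) (hr : r ≠ 0)
    (U : ℂ → ℂ) {C₈₃ K ℓ₀ : ℝ} (hC₈₃ : 0 ≤ C₈₃) (hK : 7 + 15 * |c'| ≤ K)
    (hKL : K * π ≤ Real.log D ^ 8) (hℓ₀ : 0 < ℓ₀) (hℓ : ℓ₀ ≤ ‖deriv χ.LFunction 1‖)
    (hE : (1 + 16 * Real.exp (9 / 2) * π ^ 2 * K ^ 2) / Real.log D ^ 15 ≤ ℓ₀ * alpha D / 4)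
    (hU3 : ∀ s : ℂ, ‖s - 1‖ ≤ 5 * alpha D → ‖U s - PiW χ d r‖ ≤
      C₈₃ * (ell D ^ 8)⁻¹ * ∏ q ∈ (d * r).primeFactors, (1 - (q : ℝ)⁻¹)⁻¹)
    {ρ : ℝ} (hρ1 : ρ ≤ 1) (hLρ : χ.LFunction ρ = 0) (hρα : 1 - ρ ≤ alpha D / 4)
    (hρL : 1 - ρ ≤ 1 / (4 * Real.log D))
    (hρE : 8 * Real.exp (9 / 2) * (1 + Real.log D) * Real.log D ^ 2 * (1 - ρ) ≤ ℓ₀ / 2)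
    {Y Λ : ℝ} (hY : 1 ≤ Y) (hαY : alpha D * Real.log Y ≤ π) (hρY : (1 - ρ) * Real.log Y ≤ 1)
    (hΛ : 1 ≤ Λ) {w : ℂ} (hw : ‖w‖ = alpha D) :
    ‖U ρ * χ.LFunction (ρ + betaJ c' D (j + 1)) * χ.LFunction (ρ + betaJ c' D (j + 2)) /
          deriv χ.LFunction ρ *
          ((Y : ℂ) ^ (((ρ - 1 : ℝ) : ℂ) - (w - beta6 D)) *
            omega1 Λ (((ρ - 1 : ℝ) : ℂ) - (w - beta6 D)) / (((ρ - 1 : ℝ) : ℂ) - (w - beta6 D))) -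
        deriv χ.LFunction 1 * PiW χ d r *
          (betaJ c' D (j + 1) * betaJ c' D (j + 2) *
            ((Y : ℂ) ^ (-(w - beta6 D)) / (-(w - beta6 D))))‖ ≤
      8 * Real.exp π / alpha D *
          (8 * (C₈₃ * (ell D ^ 8)⁻¹ * ∏ q ∈ (d * r).primeFactors, (1 - (q : ℝ)⁻¹)⁻¹) *
              (2 * Real.exp (9 / 2) * (1 + Real.log D) * Real.log D) * K ^ 2 * alpha D ^ 2 +
            6 * (∏ q ∈ (d * r).primeFactors, (1 - (q : ℝ)⁻¹)⁻¹) ^ 2 * K * alpha D *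
              ((1 + 16 * Real.exp (9 / 2) * π ^ 2 * K ^ 2) / Real.log D ^ 15) +
            2 * (∏ q ∈ (d * r).primeFactors, (1 - (q : ℝ)⁻¹)⁻¹) ^ 2 * K ^ 2 * alpha D ^ 2 *
              (8 * Real.exp (9 / 2) * (1 + Real.log D) * Real.log D ^ 2 * (1 - ρ)) +
            4 * (∏ q ∈ (d * r).primeFactors, (1 - (q : ℝ)⁻¹)⁻¹) ^ 2 * K * alpha D *
              ((1 + 16 * Real.exp (9 / 2) * π ^ 2 * K ^ 2) / Real.log D ^ 15)) +
        (∏ q ∈ (d * r).primeFactors, (1 - (q : ℝ)⁻¹)⁻¹) ^ 2 * K ^ 2 * alpha D ^ 2 *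
          (Real.exp π *
            ((2 * Real.exp 1 * ((1 + 16 * Real.exp (9 / 2) * π ^ 2 * K ^ 2) / Real.log D ^ 15) * Real.log Y +
                (2 * Real.exp (9 / 2) * (1 + Real.log D) * Real.log D) / (2 * Λ)) * (4 / alpha D) +
              ((1 + 16 * Real.exp (9 / 2) * π ^ 2 * K ^ 2) / Real.log D ^ 15) * (8 / alpha D ^ 2))) := by
  set 𝓛 : ℝ := Real.log D with h𝓛def
  set α : ℝ := alpha D with hαdef
  set βa : ℂ := betaJ c' D (j + 1) with hβadef
  set βb : ℂ := betaJ c' D (j + 2) with hβbdef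
  set hatPi : ℝ := ∏ q ∈ (d * r).primeFactors, (1 - (q : ℝ)⁻¹)⁻¹ with hhatPi
  set E : ℝ := (1 + 16 * Real.exp (9 / 2) * π ^ 2 * K ^ 2) / 𝓛 ^ 15 with hEdef
  set E' : ℝ := 8 * Real.exp (9 / 2) * (1 + 𝓛) * 𝓛 ^ 2 * (1 - ρ) with hE'def
  set ℓ : ℂ := deriv χ.LFunction 1 with hℓdef
  set ℓ₁ : ℝ := 2 * Real.exp (9 / 2) * (1 + 𝓛) * 𝓛 with hℓ₁def
  have hℓ2 : 2 ≤ ell D := by rw [ell]; linarith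
  have h𝓛0 : 0 < 𝓛 := by linarith
  have hα0 : 0 < α := alpha_pos' (by linarith)
  have hαeq : α = π / 𝓛 ^ 9 := alpha_eq D
  have hαℓ : α * ell D ≤ 1 := alpha_mul_ell_le_one hℓ2
  have hα5 : α ≤ 1 / 5 := by
    rw [hαeq, div_le_iff₀ (by positivity)]
    have h9 : (3 : ℝ) ^ 9 ≤ 𝓛 ^ 9 := pow_le_pow_left₀ (by norm_num) h𝓛 9
    nlinarith [Real.pi_le_four]
  have hK1 : 1 ≤ K := by linarith [abs_nonneg c']
  have hκ0 : ρ - 1 ≤ 0 := by linarith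
  have hκ : -(α / 4) ≤ ρ - 1 := by rw [hαdef]; linarith
  have habsκ : |ρ - 1| = 1 - ρ := by rw [abs_of_nonpos hκ0]; ring
  -- the variable `s = w − β₆`
  set s : ℂ := w - beta6 D with hsdef
  obtain ⟨hs_lo, hs_hi⟩ := norm_w_sub_beta6_bounds h𝓛 hw
  rw [← hsdef, ← hαdef] at hs_lo hs_hi
  have hs1 : ‖s‖ ≤ 1 / 2 := by linarith
  have hsre : -α ≤ s.re := by
    have h1 : s.re = w.re := by simp [hsdef, beta6]
    rw [h1]
    have h2 : |w.re| ≤ ‖w‖ := Complex.abs_re_le_norm w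
    rw [hw] at h2
    linarith [neg_abs_le w.re]
  -- sizes of the shifts
  have hβ : ∀ i : ℕ, ‖betaJ c' D i‖ ≤ 3 * α * (1 + 5 * |c'|) := by
    intro i
    have h := norm_betaJ_le c' D i hα0.le (by linarith : 0 ≤ ell D)
    refine h.trans ?_
    have : 5 * |c'| * alpha D * ell D ≤ 5 * |c'| := by
      calc 5 * |c'| * alpha D * ell D = 5 * |c'| * (alpha D * ell D) := by ring
        _ ≤ 5 * |c'| * 1 := by gcongr
        _ = 5 * |c'| := mul_one _
    rw [← hαdef] at this ⊢
    nlinarith [abs_nonneg c']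
  have haK : ‖βa‖ ≤ K * α := by
    calc ‖βa‖ ≤ 3 * α * (1 + 5 * |c'|) := hβ _
      _ ≤ K * α := by nlinarith [abs_nonneg c']
  have hbK : ‖βb‖ ≤ K * α := by
    calc ‖βb‖ ≤ 3 * α * (1 + 5 * |c'|) := hβ _
      _ ≤ K * α := by nlinarith [abs_nonneg c']
  -- `A = (ρ̃ − 1) + β_a`, `B = (ρ̃ − 1) + β_b`
  set A : ℂ := ((ρ - 1 : ℝ) : ℂ) + βa with hAdef
  set B : ℂ := ((ρ - 1 : ℝ) : ℂ) + βb with hBdef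
  have hκn : ‖((ρ - 1 : ℝ) : ℂ)‖ = 1 - ρ := by
    rw [Complex.norm_real, Real.norm_eq_abs, habsκ]
  have hAK : ‖A‖ ≤ K * α := by
    calc ‖A‖ ≤ ‖((ρ - 1 : ℝ) : ℂ)‖ + ‖βa‖ := norm_add_le _ _
      _ ≤ α / 4 + 3 * α * (1 + 5 * |c'|) := by rw [hκn]; exact add_le_add (by linarith) (hβ _)
      _ ≤ K * α := by nlinarith [abs_nonneg c']
  have hBK : ‖B‖ ≤ K * α := by
    calc ‖B‖ ≤ ‖((ρ - 1 : ℝ) : ℂ)‖ + ‖βb‖ := norm_add_le _ _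
      _ ≤ α / 4 + 3 * α * (1 + 5 * |c'|) := by rw [hκn]; exact add_le_add (by linarith) (hβ _)
      _ ≤ K * α := by nlinarith [abs_nonneg c']
  have hAa : ‖A - βa‖ ≤ 1 - ρ := by rw [hAdef, add_sub_cancel_right, hκn]
  have hBb : ‖B - βb‖ ≤ 1 - ρ := by rw [hBdef, add_sub_cancel_right, hκn]
  -- Lemma 5.8 at `1 + A`, `1 + B`
  have h58 : ∀ z : ℂ, ‖z‖ ≤ K * α → ‖χ.LFunction (1 + z) - ℓ * z‖ ≤ E := by
    intro z hz
    have hz' : ‖(1 + z) - 1‖ ≤ K * π / Real.log D ^ 9 := by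
      rw [add_sub_cancel_left, ← h𝓛def]
      calc ‖z‖ ≤ K * α := hz
        _ = K * π / 𝓛 ^ 9 := by rw [hαeq]; ring
    have h := Repair.Gap.lemma58_of_norm_le_pow15 χ hprim h𝓛 h15 hKL hz'
    rw [add_sub_cancel_left] at h
    exact h
  have hρA : (ρ : ℂ) + βa = 1 + A := by rw [hAdef]; push_cast; ring
  have hρB : (ρ : ℂ) + βb = 1 + B := by rw [hBdef]; push_cast; ring
  have ha : ‖χ.LFunction ((ρ : ℂ) + βa) - ℓ * A‖ ≤ E := by rw [hρA]; exact h58 _ hAK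
  have hb : ‖χ.LFunction ((ρ : ℂ) + βb) - ℓ * B‖ ≤ E := by rw [hρB]; exact h58 _ hBK
  -- Lemma 5.8 at the exceptional zero itself: `‖L′(1,χ)‖·(1 − ρ̃) = ‖L(ρ̃) − L′(1,χ)(ρ̃ − 1)‖ ≤ E`
  have hℓδ : ‖ℓ‖ * (1 - ρ) ≤ E := by
    have hz : ‖(((ρ - 1 : ℝ)) : ℂ)‖ ≤ K * α := by
      rw [hκn]
      have : α / 4 ≤ K * α := by nlinarith [hα0.le]
      linarith
    have h := h58 _ hz
    have e1 : (1 : ℂ) + ((ρ - 1 : ℝ) : ℂ) = (ρ : ℂ) := by push_cast; ring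
    rw [e1, hLρ, zero_sub, norm_neg, norm_mul, hκn] at h
    exact h
  -- `L′(ρ̃) − L′(1)`
  have h0 : ‖deriv χ.LFunction ρ - ℓ‖ ≤ E' := by
    have hβ' : ‖(((1 - ρ : ℝ)) : ℂ)‖ ≤ 1 / (4 * Real.log D) := by
      rw [Complex.norm_real, Real.norm_eq_abs, abs_of_nonneg (by linarith)]; exact hρL
    have h := U055.norm_deriv_LFunction_sub_le χ h𝓛 hprim hβ'
    have e : (1 : ℂ) - (((1 - ρ : ℝ)) : ℂ) = (ρ : ℂ) := by push_cast; ring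
    rw [e, Complex.norm_real, Real.norm_eq_abs, abs_of_nonneg (by linarith : (0 : ℝ) ≤ 1 - ρ)] at h
    rw [hE'def]
    exact h
  -- Lemma 8.3 (iii′) at `ρ̃`
  have hu : ‖U ρ - PiW χ d r‖ ≤ C₈₃ * (ell D ^ 8)⁻¹ * hatPi :=
    hU3 _ (by
      have : (ρ : ℂ) - 1 = ((ρ - 1 : ℝ) : ℂ) := by push_cast; ring
      rw [this, hκn]; linarith)
  have hE0 : 0 ≤ E := by positivity
  have hhat0 : 0 ≤ hatPi := Finset.prod_nonneg fun q hq => by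
    have hq2 : (2 : ℝ) ≤ q := by exact_mod_cast (Nat.prime_of_mem_primeFactors hq).two_le
    have : (q : ℝ)⁻¹ ≤ 1 / 2 := by rw [inv_eq_one_div]; gcongr
    exact inv_nonneg.2 (by linarith)
  have hEU0 : 0 ≤ C₈₃ * (ell D ^ 8)⁻¹ * hatPi := by positivity
  have hE'0 : 0 ≤ E' := by
    rw [hE'def]
    have h1 : 0 ≤ 1 - ρ := by linarith
    have h2 : 0 ≤ 8 * Real.exp (9 / 2) * (1 + 𝓛) * 𝓛 ^ 2 := by positivity
    exact mul_nonneg h2 h1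
  have hE'ℓ : E' ≤ ℓ₀ / 2 := hρE
  -- the coefficient algebra
  have hcoef := norm_coeff_sub_model_le (u := U ρ) (La := χ.LFunction ((ρ : ℂ) + βa))
    (Lb := χ.LFunction ((ρ : ℂ) + βb)) (L0 := deriv χ.LFunction ρ) (Pv := PiW χ d r) (ℓ := ℓ)
    (A := A) (B := B) (a := βa) (b := βb) hα0 hK1 hℓ₀ hℓ hE0 hEU0 hE'0 (by linarith) hE hE'ℓ
    ha hb h0 hu hAK hBK haK hbK hAa hBb
  -- the kernel
  have hker := norm_kernel_le (Y := Y) (Λ := Λ) (s := s) hα0 hκ0 hκ hs_lo hs1 hsre hY hαY hΛ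
  have hkerd := norm_kernel_sub_le (Y := Y) (Λ := Λ) (s := s) hα0 hκ0 hκ hs_lo hs1 hsre hY hαY
    (by rw [habsκ]; exact hρY) hΛ
  have eκ : (((ρ - 1 : ℝ)) : ℂ) = ((ρ - 1 : ℝ) : ℂ) := rfl
  -- combine: `rK − Πℓab·K₀ = (r − Πℓab)K + Πℓab(K − K₀)`
  set Kτ : ℂ := (Y : ℂ) ^ (((ρ - 1 : ℝ) : ℂ) - s) * omega1 Λ (((ρ - 1 : ℝ) : ℂ) - s) /
    (((ρ - 1 : ℝ) : ℂ) - s) with hKτ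
  set K₀ : ℂ := (Y : ℂ) ^ (-s) / (-s) with hK₀
  set rr : ℂ := U ρ * χ.LFunction ((ρ : ℂ) + βa) * χ.LFunction ((ρ : ℂ) + βb) /
    deriv χ.LFunction ρ with hrr
  have hsplit : rr * Kτ - ℓ * PiW χ d r * (βa * βb * K₀) =
      (rr - PiW χ d r * ℓ * βa * βb) * Kτ + PiW χ d r * ℓ * βa * βb * (Kτ - K₀) := by ring
  rw [hsplit]
  have hPi : ‖PiW χ d r‖ ≤ hatPi ^ 2 := norm_PiW_le_prodInv χ hd hr
  have hℓle : ‖ℓ‖ ≤ ℓ₁ :=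
    Lemma31.norm_deriv_LFunction_le_near_one χ h𝓛 hprim (w := 1)
      (by rw [sub_self, norm_zero]; positivity)
  have h1 : ‖(rr - PiW χ d r * ℓ * βa * βb) * Kτ‖ ≤
      (8 * (C₈₃ * (ell D ^ 8)⁻¹ * hatPi) * ℓ₁ * K ^ 2 * α ^ 2 + 6 * hatPi ^ 2 * K * α * E +
        2 * hatPi ^ 2 * K ^ 2 * α ^ 2 * E' + 4 * hatPi ^ 2 * K * α * E) *
        (8 * Real.exp π / α) := by
    rw [norm_mul]
    refine mul_le_mul (hcoef.trans ?_) hker (norm_nonneg _) (by positivity)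
    have hδ0 : 0 ≤ 1 - ρ := by linarith
    have hK0 : 0 ≤ K := by linarith
    have t4 : 4 * ‖PiW χ d r‖ * ‖ℓ‖ * K * α * (1 - ρ) ≤ 4 * hatPi ^ 2 * K * α * E := by
      calc 4 * ‖PiW χ d r‖ * ‖ℓ‖ * K * α * (1 - ρ) = 4 * ‖PiW χ d r‖ * K * α * (‖ℓ‖ * (1 - ρ)) := by ring
        _ ≤ 4 * hatPi ^ 2 * K * α * E := by gcongr
    have t123 : 8 * (C₈₃ * (ell D ^ 8)⁻¹ * hatPi) * ‖ℓ‖ * K ^ 2 * α ^ 2 + 6 * ‖PiW χ d r‖ * K * α * E +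
        2 * ‖PiW χ d r‖ * K ^ 2 * α ^ 2 * E' ≤
        8 * (C₈₃ * (ell D ^ 8)⁻¹ * hatPi) * ℓ₁ * K ^ 2 * α ^ 2 + 6 * hatPi ^ 2 * K * α * E +
        2 * hatPi ^ 2 * K ^ 2 * α ^ 2 * E' := by gcongr
    linarith
  have h2 : ‖PiW χ d r * ℓ * βa * βb * (Kτ - K₀)‖ ≤
      hatPi ^ 2 * K ^ 2 * α ^ 2 *
        (Real.exp π * ((2 * Real.exp 1 * E * Real.log Y + ℓ₁ / (2 * Λ)) * (4 / α) + E * (8 / α ^ 2))) := by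
    -- `‖Πℓab(K−K₀)‖ ≤ Π̂²·(Kα)²·(‖ℓ‖·‖K − K₀‖)` and `‖ℓ‖·|ρ̃−1| ≤ E`, `‖ℓ‖ ≤ ℓ₁`
    have hstep : ‖PiW χ d r * ℓ * βa * βb * (Kτ - K₀)‖ ≤
        hatPi ^ 2 * (K * α) * (K * α) * (‖ℓ‖ * ‖Kτ - K₀‖) := by
      rw [norm_mul, norm_mul, norm_mul, norm_mul]
      calc ‖PiW χ d r‖ * ‖ℓ‖ * ‖βa‖ * ‖βb‖ * ‖Kτ - K₀‖
          = ‖PiW χ d r‖ * ‖βa‖ * ‖βb‖ * (‖ℓ‖ * ‖Kτ - K₀‖) := by ring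
        _ ≤ hatPi ^ 2 * (K * α) * (K * α) * (‖ℓ‖ * ‖Kτ - K₀‖) := by gcongr
    refine hstep.trans ?_
    have hlogY0 : 0 ≤ Real.log Y := Real.log_nonneg hY
    have hℓ0 : 0 ≤ ‖ℓ‖ := norm_nonneg _
    have hin : ‖ℓ‖ * ‖Kτ - K₀‖ ≤
        Real.exp π * ((2 * Real.exp 1 * E * Real.log Y + ℓ₁ / (2 * Λ)) * (4 / α) + E * (8 / α ^ 2)) := by
      calc ‖ℓ‖ * ‖Kτ - K₀‖
          ≤ ‖ℓ‖ * (Real.exp π * ((2 * Real.exp 1 * |ρ - 1| * Real.log Y + 1 / (2 * Λ)) * (4 / α) +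
              |ρ - 1| * (8 / α ^ 2))) := mul_le_mul_of_nonneg_left hkerd hℓ0
        _ = Real.exp π * ((2 * Real.exp 1 * (‖ℓ‖ * (1 - ρ)) * Real.log Y + ‖ℓ‖ / (2 * Λ)) * (4 / α) +
              (‖ℓ‖ * (1 - ρ)) * (8 / α ^ 2)) := by rw [habsκ]; ring
        _ ≤ Real.exp π * ((2 * Real.exp 1 * E * Real.log Y + ℓ₁ / (2 * Λ)) * (4 / α) + E * (8 / α ^ 2)) := by
              gcongr
    calc hatPi ^ 2 * (K * α) * (K * α) * (‖ℓ‖ * ‖Kτ - K₀‖)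
        ≤ hatPi ^ 2 * (K * α) * (K * α) *
            (Real.exp π * ((2 * Real.exp 1 * E * Real.log Y + ℓ₁ / (2 * Λ)) * (4 / α) + E * (8 / α ^ 2))) := by
          gcongr
      _ = _ := by ring
  calc ‖(rr - PiW χ d r * ℓ * βa * βb) * Kτ + PiW χ d r * ℓ * βa * βb * (Kτ - K₀)‖
      ≤ ‖(rr - PiW χ d r * ℓ * βa * βb) * Kτ‖ + ‖PiW χ d r * ℓ * βa * βb * (Kτ - K₀)‖ :=
        norm_add_le _ _
    _ ≤ _ := add_le_add h1 h2
    _ = _ := by ring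

end Literature.NumberTheory.LFunctions.Zhang2022.Lemma84

end
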